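import Summits.CriticalPhenomena.Ising3D.IsingColumnFaceL11CensusSegmentLinCands

/-!
# The `LIN` census of §7.3 on the certified `Δε` segment as kernel facts, IV: the kernel evaluations of
parts `1, 3` (cell `pub-ising3x`, seat recog-1; paper §7.1 / §7.3)

HONEST FRAMING: lottery ticket; floor = tightest certified 3D Ising CFT bounds; no exact-solution
claim without a proof. Island framing: certified exclusion region at stated derivative order and
assumptions; not a determination of the 3D Ising critical exponents beyond that.

Kernel evaluations `linSegCheck i n₀ n₁ n₂ = true` of the enumerate-and-decide machine of
`IsingColumnFaceL11CensusSegmentLin{,Cands}.lean` (part `i` = the coefficient vectors whose first non-zero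
entry sits at index `i`; one `decide +kernel` each; this file ≈ 155 s of kernel time): every candidate of
the part is decided, the tuple codes strictly increase, and the part has `n₀ / n₁ / n₂` primitive candidates
in the sub-window bins `[81/64, 13/10]` / `[13/10, 27/20]` / `[27/20, 2855/2048]`. The counts are the Python
twin's (recog-1 gen 51 `twin_lintrg.py`, same enclosures); the kernel CONFIRMS them here. Companions:
`…SegmentLinA.lean` (parts `0, 5, 6`), `…SegmentLinC.lean` (parts `2, 4` and the theorems). Pure arithmetic; no certificate, no datum, no σ–ε axiom; nothing is recognised.
lottery ticket; floor = tightest certified 3D Ising CFT bounds; no exact-solution claim without a proof.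
-/

namespace Summit.CriticalPhenomena.Ising3D
namespace ColumnFaceL11
open Set Literature.MathematicalPhysics.QuantumFieldTheory.ConformalBootstrap3D

/-- Part `1` (2904 vectors): all candidates decided, codes increasing, `7148 / 10360 / 9181` primitive
candidates in the three sub-window bins. [folklore] -/
theorem linSegCheck_p1 : linSegCheck 1 7148 10360 9181 = true := by
  decide +kernel

/-- Part `3` (1752 vectors): all candidates decided, codes increasing, `4299 / 6262 / 5552` primitive
candidates in the three sub-window bins. [folklore] -/
theorem linSegCheck_p3 : linSegCheck 3 4299 6262 5552 = true := by
  decide +kernel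

end ColumnFaceL11
end Summit.CriticalPhenomena.Ising3D
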